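import Summits.HubbardSuperconductivity.HubbardSuperconductivity.Theorems.ThermalWedgeTwSeededEnsembleEquivalenceThermalCloserCore

/-!
# Crux `TwSeededEnsembleEquivalence` (stmt-HubbardSuperconductivity-1698), line `exposed-density-duality`
# (thermal member, skeleton v12) — stub `stub_thermalCloser` (STUB E, the lead's), part 2: the stub

CHERNOFF + WALK. For the seeded grand-canonical torus `K_L(μ) = hubbardTorusWith 2 L 1 U μ − (g/L²)P_L` write
`W_L(N; μ) = Σ_{|s| = N} Re (e^{−βK_L(μ)})_{ss}` for the particle-number sector weights and `Z_L(μ) = Re tr e^{−βK_L(μ)}`.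
Given (hA) the sector-weight basics (sector decomposition of `Z`, `μ`-tilt, positivity, probabilistic normal form of the
defect), (hW) the thermal one-particle walk at `μ = 0` with constant `C L²`, and (hBr) a two-sided secant bracket of the
finite-volume pressure `p_L(β,·) = log Z_L(·)/(βL²)` at an `L`-independent `μ₀` (tolerance `η ↦ τ(η)`, eventually in `L`),
the crux instance `e_L + p_L(β, μ₀) − μ₀ n_L ≤ log 4/β + ε` holds eventually in `L`:
* `walk_ratio_down` / `walk_ratio_up` transport one step of the `μ = 0` walk to `μ₀` (ratio `≤ 5e^{β(|μ₀|+2C)}` on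
  `L²/2 ≤ N ≤ L²`) and feed `chernoffWalk_core` (part 1), which gives
  `log (Z(μ₀)/W(N_L; μ₀)) ≤ log 2 + log (2L² + 1) + (2ηL² + 2)(log 5 + β(|μ₀| + 2C))`;
* with `η = min(1/20, ε/(4ℓ₁+1))`, `ℓ₁ = log 5 + |μ₀| + 2C`, and `L ≥ max(L_br(η), 20, 2/(τη), 2(5+2ℓ₁)/ε)` the right-hand
  side is `≤ βL²ε` (`closer_rhs_le`), and the normal form (hA.d) divided by `βL²` (`closer_divide`) is the claim.

Bratteli–Robinson II §5.3 (large deviations of the particle number in a Gibbs state); folklore.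
-/

set_option linter.dupNamespace false

namespace Summit.HubbardSuperconductivity.HubbardSuperconductivity.Theorems.TwSeededEnsembleEquivalence.ThermalDuality

open Matrix Finset Literature.MathematicalPhysics.QuantumLattice
open scoped ComplexOrder Matrix.Norms.L2Operator

noncomputable section

/-! ## One step of the walk, transported to `μ₀` -/

/-- ONE DOWN-STEP OF THE WALK AT `μ₀`. From the `μ = 0` walk `W(n;0) ≤ ((2L²−n+1)/n) e^{βCL²/n} W(n−1;0)` and the
tilt, for `L²/2 ≤ n ≤ 2L²`: `W(n; μ₀) ≤ 5 e^{β(|μ₀|+2C)} W(n−1; μ₀)`. [folklore] -/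
theorem walk_ratio_down {W : ℕ → ℝ → ℝ} {L n : ℕ} {β C μ₀ : ℝ} (hβ : 0 ≤ β) (hC : 0 ≤ C)
    (htilt : ∀ μ μ' N, W N μ' = Real.exp (β * (μ' - μ) * N) * W N μ)
    (hWpos : 0 < W (n - 1) μ₀)
    (hdown : W n 0 ≤ (2 * (L : ℝ) ^ 2 - n + 1) / n * Real.exp (β * (C * (L : ℝ) ^ 2) / n) * W (n - 1) 0)
    (hn1 : 1 ≤ n) (hnlo : (L : ℝ) ^ 2 / 2 ≤ n) :
    W n μ₀ ≤ 5 * Real.exp (β * (|μ₀| + 2 * C)) * W (n - 1) μ₀ := by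
  have hnpos : (0 : ℝ) < n := by exact_mod_cast hn1
  have hcast : ((n - 1 : ℕ) : ℝ) = (n : ℝ) - 1 := by rw [Nat.cast_sub hn1]; simp
  have h1 : W n μ₀ = Real.exp (β * μ₀ * n) * W n 0 := by rw [htilt 0 μ₀ n]; ring_nf
  have h2 : W (n - 1) 0 = Real.exp (-(β * μ₀ * ((n : ℝ) - 1))) * W (n - 1) μ₀ := by
    rw [htilt μ₀ 0 (n - 1), hcast]; ring_nf
  have hr1 : (2 * (L : ℝ) ^ 2 - n + 1) / n ≤ 5 := by rw [div_le_iff₀ hnpos]; nlinarith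
  have hr2 : Real.exp (β * (C * (L : ℝ) ^ 2) / n) ≤ Real.exp (β * (2 * C)) := by
    apply Real.exp_le_exp.mpr
    rw [div_le_iff₀ hnpos]
    have : β * C * (L : ℝ) ^ 2 ≤ β * C * (2 * n) := mul_le_mul_of_nonneg_left (by linarith) (by positivity)
    nlinarith
  have hr3 : Real.exp (β * μ₀ * n) * Real.exp (-(β * μ₀ * ((n : ℝ) - 1))) = Real.exp (β * μ₀) := by
    rw [← Real.exp_add]; ring_nf
  have hr4 : Real.exp (β * μ₀) ≤ Real.exp (β * |μ₀|) :=
    Real.exp_le_exp.mpr (mul_le_mul_of_nonneg_left (le_abs_self μ₀) hβ)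
  have hprod : (2 * (L : ℝ) ^ 2 - n + 1) / n * Real.exp (β * (C * (L : ℝ) ^ 2) / n) * Real.exp (β * μ₀) ≤
      5 * Real.exp (β * (2 * C)) * Real.exp (β * |μ₀|) := by
    gcongr
  have hρ : 5 * Real.exp (β * (2 * C)) * Real.exp (β * |μ₀|) = 5 * Real.exp (β * (|μ₀| + 2 * C)) := by
    rw [mul_add, Real.exp_add]; ring
  calc W n μ₀ = Real.exp (β * μ₀ * n) * W n 0 := h1
    _ ≤ Real.exp (β * μ₀ * n) * ((2 * (L : ℝ) ^ 2 - n + 1) / n * Real.exp (β * (C * (L : ℝ) ^ 2) / n) *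
          W (n - 1) 0) := mul_le_mul_of_nonneg_left hdown (Real.exp_pos _).le
    _ = (2 * (L : ℝ) ^ 2 - n + 1) / n * Real.exp (β * (C * (L : ℝ) ^ 2) / n) *
          (Real.exp (β * μ₀ * n) * Real.exp (-(β * μ₀ * ((n : ℝ) - 1)))) * W (n - 1) μ₀ := by
        rw [h2]; ring
    _ = (2 * (L : ℝ) ^ 2 - n + 1) / n * Real.exp (β * (C * (L : ℝ) ^ 2) / n) * Real.exp (β * μ₀) *
          W (n - 1) μ₀ := by rw [hr3]
    _ ≤ 5 * Real.exp (β * (2 * C)) * Real.exp (β * |μ₀|) * W (n - 1) μ₀ :=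
        mul_le_mul_of_nonneg_right hprod hWpos.le
    _ = 5 * Real.exp (β * (|μ₀| + 2 * C)) * W (n - 1) μ₀ := by rw [hρ]

/-- ONE UP-STEP OF THE WALK AT `μ₀`. From the `μ = 0` walk `W(n;0) ≤ ((n+1)/(2L²−n)) e^{βCL²/(2L²−n)} W(n+1;0)` and
the tilt, for `n ≤ L²`: `W(n; μ₀) ≤ 5 e^{β(|μ₀|+2C)} W(n+1; μ₀)`. [folklore] -/
theorem walk_ratio_up {W : ℕ → ℝ → ℝ} {L n : ℕ} {β C μ₀ : ℝ} (hβ : 0 ≤ β) (hC : 0 ≤ C)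
    (htilt : ∀ μ μ' N, W N μ' = Real.exp (β * (μ' - μ) * N) * W N μ)
    (hWpos : 0 < W (n + 1) μ₀)
    (hup : W n 0 ≤ (n + 1) / (2 * (L : ℝ) ^ 2 - n) * Real.exp (β * (C * (L : ℝ) ^ 2) / (2 * (L : ℝ) ^ 2 - n)) *
      W (n + 1) 0)
    (hnhi : (n : ℝ) ≤ (L : ℝ) ^ 2) (hV : 1 ≤ (L : ℝ) ^ 2) :
    W n μ₀ ≤ 5 * Real.exp (β * (|μ₀| + 2 * C)) * W (n + 1) μ₀ := by
  have hn0 : (0 : ℝ) ≤ n := Nat.cast_nonneg n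
  have hden : 0 < 2 * (L : ℝ) ^ 2 - n := by linarith
  have h1 : W n μ₀ = Real.exp (β * μ₀ * n) * W n 0 := by rw [htilt 0 μ₀ n]; ring_nf
  have h2 : W (n + 1) 0 = Real.exp (-(β * μ₀ * ((n : ℝ) + 1))) * W (n + 1) μ₀ := by
    rw [htilt μ₀ 0 (n + 1)]; push_cast; ring_nf
  have hr1 : ((n : ℝ) + 1) / (2 * (L : ℝ) ^ 2 - n) ≤ 5 := by rw [div_le_iff₀ hden]; nlinarith
  have hr2 : Real.exp (β * (C * (L : ℝ) ^ 2) / (2 * (L : ℝ) ^ 2 - n)) ≤ Real.exp (β * (2 * C)) := by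
    apply Real.exp_le_exp.mpr
    rw [div_le_iff₀ hden]
    have : β * C * (L : ℝ) ^ 2 ≤ β * C * (2 * (2 * (L : ℝ) ^ 2 - n)) :=
      mul_le_mul_of_nonneg_left (by linarith) (by positivity)
    nlinarith
  have hr3 : Real.exp (β * μ₀ * n) * Real.exp (-(β * μ₀ * ((n : ℝ) + 1))) = Real.exp (-(β * μ₀)) := by
    rw [← Real.exp_add]; ring_nf
  have hr4 : Real.exp (-(β * μ₀)) ≤ Real.exp (β * |μ₀|) := by
    apply Real.exp_le_exp.mpr
    have h := mul_le_mul_of_nonneg_left (neg_abs_le μ₀) hβ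
    linarith
  have hprod : ((n : ℝ) + 1) / (2 * (L : ℝ) ^ 2 - n) * Real.exp (β * (C * (L : ℝ) ^ 2) / (2 * (L : ℝ) ^ 2 - n)) *
      Real.exp (-(β * μ₀)) ≤ 5 * Real.exp (β * (2 * C)) * Real.exp (β * |μ₀|) := by
    gcongr
  have hρ : 5 * Real.exp (β * (2 * C)) * Real.exp (β * |μ₀|) = 5 * Real.exp (β * (|μ₀| + 2 * C)) := by
    rw [mul_add, Real.exp_add]; ring
  calc W n μ₀ = Real.exp (β * μ₀ * n) * W n 0 := h1
    _ ≤ Real.exp (β * μ₀ * n) * ((n + 1) / (2 * (L : ℝ) ^ 2 - n) *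
          Real.exp (β * (C * (L : ℝ) ^ 2) / (2 * (L : ℝ) ^ 2 - n)) * W (n + 1) 0) :=
        mul_le_mul_of_nonneg_left hup (Real.exp_pos _).le
    _ = ((n : ℝ) + 1) / (2 * (L : ℝ) ^ 2 - n) * Real.exp (β * (C * (L : ℝ) ^ 2) / (2 * (L : ℝ) ^ 2 - n)) *
          (Real.exp (β * μ₀ * n) * Real.exp (-(β * μ₀ * ((n : ℝ) + 1)))) * W (n + 1) μ₀ := by
        rw [h2]; ring
    _ = ((n : ℝ) + 1) / (2 * (L : ℝ) ^ 2 - n) * Real.exp (β * (C * (L : ℝ) ^ 2) / (2 * (L : ℝ) ^ 2 - n)) *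
          Real.exp (-(β * μ₀)) * W (n + 1) μ₀ := by rw [hr3]
    _ ≤ 5 * Real.exp (β * (2 * C)) * Real.exp (β * |μ₀|) * W (n + 1) μ₀ :=
        mul_le_mul_of_nonneg_right hprod hWpos.le
    _ = 5 * Real.exp (β * (|μ₀| + 2 * C)) * W (n + 1) μ₀ := by rw [hρ]

/-! ## Arithmetic of the final choice of `η` and `L₀` -/

/-- `2ηℓ ≤ ε/2` from `η(4ℓ+1) ≤ ε`, `η ≥ 0`. [folklore] -/
theorem closer_arith_eta {η ℓ ε : ℝ} (hη : 0 ≤ η) (h : η * (4 * ℓ + 1) ≤ ε) : 2 * η * ℓ ≤ ε / 2 := by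
  nlinarith

/-- `1 + 4L + 2ℓ ≤ (ε/2)L²` once `L ≥ 2(5 + 2ℓ)/ε`, `L ≥ 1`, `ℓ ≥ 0`. [folklore] -/
theorem closer_arith_L {L ℓ ε : ℝ} (hL : 1 ≤ L) (hℓ : 0 ≤ ℓ) (hε : 0 < ε) (h : 2 * (5 + 2 * ℓ) / ε ≤ L) :
    1 + 4 * L + 2 * ℓ ≤ ε / 2 * L ^ 2 := by
  rw [div_le_iff₀ hε] at h
  have h1 : L * (2 * (5 + 2 * ℓ)) ≤ L * (L * ε) := mul_le_mul_of_nonneg_left h (by linarith)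
  nlinarith

/-- The right-hand side of `chernoffWalk_core` is at most `βL²ε` for the closer's `η` and `L`. [folklore] -/
theorem closer_rhs_le {β L η ε μ₀ C : ℝ} (hβ : 1 ≤ β) (hL : 1 ≤ L) (hC : 0 ≤ C) (hη : 0 ≤ η)
    (hηε : 2 * η * (Real.log 5 + |μ₀| + 2 * C) ≤ ε / 2)
    (hLε : 1 + 4 * L + 2 * (Real.log 5 + |μ₀| + 2 * C) ≤ ε / 2 * L ^ 2) :
    Real.log 2 + Real.log (2 * L ^ 2 + 1) + (2 * η * L ^ 2 + 2) * (Real.log 5 + β * (|μ₀| + 2 * C)) ≤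
      β * L ^ 2 * ε := by
  set ℓ₁ : ℝ := Real.log 5 + |μ₀| + 2 * C with hℓ₁def
  have hlog5 : 0 ≤ Real.log 5 := Real.log_nonneg (by norm_num)
  have hℓ₁ : 0 ≤ ℓ₁ := by rw [hℓ₁def]; positivity
  have hβ0 : 0 ≤ β := by linarith
  have hV : 0 ≤ L ^ 2 := by positivity
  have h1 : Real.log 2 ≤ β := by
    have := Real.log_two_lt_d9; linarith
  have h2 : Real.log (2 * L ^ 2 + 1) ≤ 4 * L := by
    have h2a : Real.log (2 * L ^ 2 + 1) ≤ Real.log ((2 * L) ^ 2) :=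
      Real.log_le_log (by positivity) (by nlinarith)
    have h2b : Real.log ((2 * L) ^ 2) = 2 * Real.log (2 * L) := by
      rw [Real.log_pow]; norm_num
    have h2c : Real.log (2 * L) ≤ 2 * L - 1 := Real.log_le_sub_one_of_pos (by positivity)
    linarith
  have h3 : Real.log 5 + β * (|μ₀| + 2 * C) ≤ β * ℓ₁ := by
    have e : β * ℓ₁ = β * Real.log 5 + β * (|μ₀| + 2 * C) := by rw [hℓ₁def]; ring
    have : Real.log 5 ≤ β * Real.log 5 := le_mul_of_one_le_left hlog5 hβ
    linarith
  have h4 : (2 * η * L ^ 2 + 2) * (Real.log 5 + β * (|μ₀| + 2 * C)) ≤ (2 * η * L ^ 2 + 2) * (β * ℓ₁) :=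
    mul_le_mul_of_nonneg_left h3 (by positivity)
  have h6 : (2 * η * ℓ₁) * (β * L ^ 2) ≤ (ε / 2) * (β * L ^ 2) :=
    mul_le_mul_of_nonneg_right hηε (by positivity)
  have h8 : β * (1 + 4 * L + 2 * ℓ₁) ≤ β * (ε / 2 * L ^ 2) := mul_le_mul_of_nonneg_left hLε hβ0
  have h9 : 4 * L ≤ β * (4 * L) := le_mul_of_one_le_left (by linarith) hβ
  calc Real.log 2 + Real.log (2 * L ^ 2 + 1) + (2 * η * L ^ 2 + 2) * (Real.log 5 + β * (|μ₀| + 2 * C))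
      ≤ β + 4 * L + (2 * η * L ^ 2 + 2) * (β * ℓ₁) := add_le_add (add_le_add h1 h2) h4
    _ = β * (1 + 2 * ℓ₁) + 4 * L + (2 * η * ℓ₁) * (β * L ^ 2) := by ring
    _ ≤ β * (1 + 2 * ℓ₁) + β * (4 * L) + (ε / 2) * (β * L ^ 2) := by linarith
    _ = β * (1 + 4 * L + 2 * ℓ₁) + (ε / 2) * (β * L ^ 2) := by ring
    _ ≤ β * (ε / 2 * L ^ 2) + (ε / 2) * (β * L ^ 2) := by linarith
    _ = β * L ^ 2 * ε := by ring

/-- Division bookkeeping of the closer: from `β(E − μN) + log Z ≤ L² log 4 + R` and `R ≤ βL²ε` to the crux's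
normalised form. [folklore] -/
theorem closer_divide {β V E N μ lZ R ε : ℝ} (hβ : 0 < β) (hV : 0 < V)
    (h : β * (E - μ * N) + lZ ≤ V * Real.log 4 + R) (hR : R ≤ β * V * ε) :
    E / V + lZ / (β * V) - μ * N / V ≤ Real.log 4 / β + ε := by
  have hβV : 0 < β * V := mul_pos hβ hV
  have key : β * (E - μ * N) + lZ ≤ V * Real.log 4 + β * V * ε := h.trans (by linarith)
  have h1 : E / V + lZ / (β * V) - μ * N / V = (β * (E - μ * N) + lZ) / (β * V) := by
    field_simp
    ring
  have h2 : Real.log 4 / β + ε = (V * Real.log 4 + β * V * ε) / (β * V) := by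
    field_simp
  rw [h1, h2]
  exact div_le_div_of_nonneg_right key hβV.le

/-- Secant rearrangement (upper): `(a/m − b/m)/τ ≤ c` gives `a − b ≤ m τ c` (`m, τ > 0`). [folklore] -/
theorem secant_rearrange_up {a b m τ c : ℝ} (hτ : 0 < τ) (hm : 0 < m) (h : (a / m - b / m) / τ ≤ c) :
    a - b ≤ m * τ * c := by
  rw [div_le_iff₀ hτ, ← sub_div, div_le_iff₀ hm] at h
  linarith

/-- Secant rearrangement (lower): `c ≤ (b/m − a/m)/τ` gives `m τ c ≤ b − a` (`m, τ > 0`). [folklore] -/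
theorem secant_rearrange_dn {a b m τ c : ℝ} (hτ : 0 < τ) (hm : 0 < m) (h : c ≤ (b / m - a / m) / τ) :
    m * τ * c ≤ b - a := by
  rw [le_div_iff₀ hτ, ← sub_div, le_div_iff₀ hm] at h
  linarith

/-! ## The stub -/

/-- STUB E — THE THERMAL CLOSER (held by the lead): CHERNOFF + WALK. Fix `δ` in the window, `U`, `g`, `β ≥ 1`, `μ₀` and
a walk constant `C ≥ 0`. Assume the sector-weight basics of `stub_sectorWeightBasics` at this `(U, g, β)` (`hA`), the
thermal walk of `stub_thermalWalk` with `R = C·L²` (`hW`), and the TWO-SIDED SECANT BRACKET of the finite-volume seeded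
pressure `p_L(β, ·)` at `μ₀`: for every `η > 0` a step `τ > 0` with `(p_L(μ₀+τ) − p_L(μ₀))/τ ≤ (1−δ) + η` and
`(1−δ) − η ≤ (p_L(μ₀) − p_L(μ₀−τ))/τ` eventually in `L` (`hBr`). Then the crux instance holds at `(β, μ₀)`:
`e_L + p_L(β,μ₀) − μ₀ n_L ≤ log 4/β + ε` eventually. Proof: by the normal form (`hA`.d) it suffices that
`log (Re Z(μ₀) / W_L(N_L; μ₀)) ≤ βεL²` eventually; the bracket and the tilt give the Chernoff tails
`Σ_{N > (1−δ+2η)L²} W_L(N; μ₀) ≤ e^{−βτηL²} Re Z(μ₀)` and likewise below `(1−δ−2η)L²`, so half of `Z(μ₀)` sits on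
`|N − (1−δ)L²| ≤ 2ηL²`; there `W_L(N; μ₀) ≤ e^{β|μ₀||N−N_L|}(4e^{2βC})^{|N−N_L|} W_L(N_L; μ₀)` by the walk (sectors
`N ≥ L²/2` on the way, `δ ≤ 2/5`), whence `log (Re Z/W_L(N_L)) ≤ log 2 + log (4ηL²+5) + (2ηL²+2)(log 4 + 2βC + β|μ₀|)`
and `η = η(ε, C, μ₀)` small closes. [folklore] -/
theorem stub_thermalCloser :
    ∀ (δ U g β μ₀ C : ℝ), δ ∈ Set.Icc (1/10 : ℝ) (2/5 : ℝ) → 1 ≤ β → 0 ≤ C →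
      (∀ (L : ℕ) [NeZero L],
        (∀ μ : ℝ,
          (Matrix.partitionFn β (hubbardTorusWith 2 L 1 U μ - ((g / (L : ℝ) ^ 2 : ℝ) : ℂ) •
            ((pairField dWaveFormFactor L)ᴴ * pairField dWaveFormFactor L))).re =
          ∑ N ∈ Finset.range (2 * L ^ 2 + 1),
            ∑ s ∈ (Finset.univ.filter fun s : Finset (Orb (FermionTorus 2 L)) => s.card = N),
              (Matrix.gibbsWeight β (hubbardTorusWith 2 L 1 U μ - ((g / (L : ℝ) ^ 2 : ℝ) : ℂ) •
                ((pairField dWaveFormFactor L)ᴴ * pairField dWaveFormFactor L)) s s).re) ∧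
        (∀ (μ μ' : ℝ) (N : ℕ),
          ∑ s ∈ (Finset.univ.filter fun s : Finset (Orb (FermionTorus 2 L)) => s.card = N),
              (Matrix.gibbsWeight β (hubbardTorusWith 2 L 1 U μ' - ((g / (L : ℝ) ^ 2 : ℝ) : ℂ) •
                ((pairField dWaveFormFactor L)ᴴ * pairField dWaveFormFactor L)) s s).re =
          Real.exp (β * (μ' - μ) * N) *
            ∑ s ∈ (Finset.univ.filter fun s : Finset (Orb (FermionTorus 2 L)) => s.card = N),
              (Matrix.gibbsWeight β (hubbardTorusWith 2 L 1 U μ - ((g / (L : ℝ) ^ 2 : ℝ) : ℂ) •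
                ((pairField dWaveFormFactor L)ᴴ * pairField dWaveFormFactor L)) s s).re) ∧
        (∀ (μ : ℝ) (N : ℕ), N ≤ 2 * L ^ 2 →
          0 < ∑ s ∈ (Finset.univ.filter fun s : Finset (Orb (FermionTorus 2 L)) => s.card = N),
              (Matrix.gibbsWeight β (hubbardTorusWith 2 L 1 U μ - ((g / (L : ℝ) ^ 2 : ℝ) : ℂ) •
                ((pairField dWaveFormFactor L)ᴴ * pairField dWaveFormFactor L)) s s).re) ∧
        (∀ (μ : ℝ) (n : ℕ), n ≤ L ^ 2 →
          β * ((hubbardTorus 2 L 1 U - ((g / (L : ℝ) ^ 2 : ℝ) : ℂ) •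
                ((pairField dWaveFormFactor L)ᴴ * pairField dWaveFormFactor L)).minEnergyOn
                  (@szSector (FermionTorus 2 L) _ _ (2 * n) 0) - μ * ((2 * n : ℕ) : ℝ)) +
            Real.log (Matrix.partitionFn β (hubbardTorusWith 2 L 1 U μ - ((g / (L : ℝ) ^ 2 : ℝ) : ℂ) •
              ((pairField dWaveFormFactor L)ᴴ * pairField dWaveFormFactor L))).re ≤
          (L : ℝ) ^ 2 * Real.log 4 +
            Real.log ((Matrix.partitionFn β (hubbardTorusWith 2 L 1 U μ - ((g / (L : ℝ) ^ 2 : ℝ) : ℂ) •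
                ((pairField dWaveFormFactor L)ᴴ * pairField dWaveFormFactor L))).re /
              ∑ s ∈ (Finset.univ.filter fun s : Finset (Orb (FermionTorus 2 L)) => s.card = 2 * n),
                (Matrix.gibbsWeight β (hubbardTorusWith 2 L 1 U μ - ((g / (L : ℝ) ^ 2 : ℝ) : ℂ) •
                  ((pairField dWaveFormFactor L)ᴴ * pairField dWaveFormFactor L)) s s).re))) →
      (∀ (L : ℕ) [NeZero L] (N : ℕ),
        (1 ≤ N → N ≤ 2 * L ^ 2 →
          ∑ s ∈ (Finset.univ.filter fun s : Finset (Orb (FermionTorus 2 L)) => s.card = N),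
              (Matrix.gibbsWeight β (hubbardTorusWith 2 L 1 U 0 - ((g / (L : ℝ) ^ 2 : ℝ) : ℂ) •
                ((pairField dWaveFormFactor L)ᴴ * pairField dWaveFormFactor L)) s s).re ≤
            ((2 * (L : ℝ) ^ 2 - N + 1) / N) * Real.exp (β * (C * (L : ℝ) ^ 2) / N) *
              ∑ s ∈ (Finset.univ.filter fun s : Finset (Orb (FermionTorus 2 L)) => s.card = N - 1),
                (Matrix.gibbsWeight β (hubbardTorusWith 2 L 1 U 0 - ((g / (L : ℝ) ^ 2 : ℝ) : ℂ) •
                  ((pairField dWaveFormFactor L)ᴴ * pairField dWaveFormFactor L)) s s).re) ∧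
        (N + 1 ≤ 2 * L ^ 2 →
          ∑ s ∈ (Finset.univ.filter fun s : Finset (Orb (FermionTorus 2 L)) => s.card = N),
              (Matrix.gibbsWeight β (hubbardTorusWith 2 L 1 U 0 - ((g / (L : ℝ) ^ 2 : ℝ) : ℂ) •
                ((pairField dWaveFormFactor L)ᴴ * pairField dWaveFormFactor L)) s s).re ≤
            ((N + 1) / (2 * (L : ℝ) ^ 2 - N)) * Real.exp (β * (C * (L : ℝ) ^ 2) / (2 * (L : ℝ) ^ 2 - N)) *
              ∑ s ∈ (Finset.univ.filter fun s : Finset (Orb (FermionTorus 2 L)) => s.card = N + 1),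
                (Matrix.gibbsWeight β (hubbardTorusWith 2 L 1 U 0 - ((g / (L : ℝ) ^ 2 : ℝ) : ℂ) •
                  ((pairField dWaveFormFactor L)ᴴ * pairField dWaveFormFactor L)) s s).re)) →
      (∀ η : ℝ, 0 < η → ∃ τ : ℝ, 0 < τ ∧ ∃ L₀ : ℕ, ∀ (L : ℕ) [NeZero L], L₀ ≤ L →
        ((Real.log (Matrix.partitionFn β (hubbardTorusWith 2 L 1 U (μ₀ + τ) - ((g / (L : ℝ) ^ 2 : ℝ) : ℂ) •
            ((pairField dWaveFormFactor L)ᴴ * pairField dWaveFormFactor L))).re / (β * (L : ℝ) ^ 2)) -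
          (Real.log (Matrix.partitionFn β (hubbardTorusWith 2 L 1 U μ₀ - ((g / (L : ℝ) ^ 2 : ℝ) : ℂ) •
            ((pairField dWaveFormFactor L)ᴴ * pairField dWaveFormFactor L))).re / (β * (L : ℝ) ^ 2))) / τ ≤
          (1 - δ) + η ∧
        (1 - δ) - η ≤
        ((Real.log (Matrix.partitionFn β (hubbardTorusWith 2 L 1 U μ₀ - ((g / (L : ℝ) ^ 2 : ℝ) : ℂ) •
            ((pairField dWaveFormFactor L)ᴴ * pairField dWaveFormFactor L))).re / (β * (L : ℝ) ^ 2)) -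
          (Real.log (Matrix.partitionFn β (hubbardTorusWith 2 L 1 U (μ₀ - τ) - ((g / (L : ℝ) ^ 2 : ℝ) : ℂ) •
            ((pairField dWaveFormFactor L)ᴴ * pairField dWaveFormFactor L))).re / (β * (L : ℝ) ^ 2))) / τ) →
      ∀ ε : ℝ, 0 < ε → ∃ L₀ : ℕ, ∀ (L : ℕ) [NeZero L], L₀ ≤ L →
        (((hubbardTorus 2 L 1 U - ((g / (L : ℝ) ^ 2 : ℝ) : ℂ) •
            ((pairField dWaveFormFactor L)ᴴ * pairField dWaveFormFactor L))).minEnergyOn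
              (@szSector (FermionTorus 2 L) _ _ (2 * ⌊(1 - δ) * (L : ℝ) ^ 2 / 2⌋₊) 0) / (L : ℝ) ^ 2) +
          (Real.log (Matrix.partitionFn β (hubbardTorusWith 2 L 1 U μ₀ - ((g / (L : ℝ) ^ 2 : ℝ) : ℂ) •
            ((pairField dWaveFormFactor L)ᴴ * pairField dWaveFormFactor L))).re / (β * (L : ℝ) ^ 2)) -
          μ₀ * ((2 * ⌊(1 - δ) * (L : ℝ) ^ 2 / 2⌋₊) : ℝ) / (L : ℝ) ^ 2 ≤ Real.log 4 / β + ε := by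
  intro δ U g β μ₀ C hδ hβ hC hA hW hBr ε hε
  have hβ0 : 0 < β := by linarith
  -- the constants
  have hlog5 : 0 ≤ Real.log 5 := Real.log_nonneg (by norm_num)
  have hℓ₁ : 0 ≤ Real.log 5 + |μ₀| + 2 * C := by positivity
  obtain ⟨η, hη, hη', hηε⟩ : ∃ η : ℝ, 0 < η ∧ η ≤ 1 / 20 ∧ 2 * η * (Real.log 5 + |μ₀| + 2 * C) ≤ ε / 2 := by
    have hden : 0 < 4 * (Real.log 5 + |μ₀| + 2 * C) + 1 := by positivity
    refine ⟨min (1 / 20) (ε / (4 * (Real.log 5 + |μ₀| + 2 * C) + 1)), lt_min (by norm_num) (div_pos hε hden),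
      min_le_left _ _, ?_⟩
    refine closer_arith_eta (le_min (by norm_num) (div_pos hε hden).le) ?_
    exact (le_div_iff₀ hden).mp (min_le_right _ _)
  obtain ⟨τ, hτ, L₁, hbr⟩ := hBr η hη
  clear hBr
  refine ⟨max (max L₁ 20) (max ⌈2 / (τ * η)⌉₊ ⌈2 * (5 + 2 * (Real.log 5 + |μ₀| + 2 * C)) / ε⌉₊), ?_⟩
  intro L _ hL
  have hL₁ : L₁ ≤ L := le_trans (le_trans (le_max_left _ _) (le_max_left _ _)) hL
  have hL20 : 20 ≤ L := le_trans (le_trans (le_max_right _ _) (le_max_left _ _)) hL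
  have hLa : ⌈2 / (τ * η)⌉₊ ≤ L := le_trans (le_trans (le_max_left _ _) (le_max_right _ _)) hL
  have hLb : ⌈2 * (5 + 2 * (Real.log 5 + |μ₀| + 2 * C)) / ε⌉₊ ≤ L :=
    le_trans (le_trans (le_max_right _ _) (le_max_right _ _)) hL
  have hL' : (20 : ℝ) ≤ L := by exact_mod_cast hL20
  have hL1 : (1 : ℝ) ≤ L := by linarith
  have hLV : (L : ℝ) ≤ (L : ℝ) ^ 2 := by nlinarith
  have hVpos : 0 < (L : ℝ) ^ 2 := by positivity
  have hβV : 0 < β * (L : ℝ) ^ 2 := by positivity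
  have hLτη : 2 / (τ * η) ≤ (L : ℝ) ^ 2 := le_trans ((Nat.le_ceil _).trans (by exact_mod_cast hLa)) hLV
  have hLε : 2 * (5 + 2 * (Real.log 5 + |μ₀| + 2 * C)) / ε ≤ L := (Nat.le_ceil _).trans (by exact_mod_cast hLb)
  have hRHS := closer_rhs_le hβ hL1 hC hη.le hηε (closer_arith_L hL1 hℓ₁ hε hLε)
  -- the data at this L
  obtain ⟨hZsum, htilt, hpos, hnf⟩ := hA L
  have hWL := hW L
  obtain ⟨hbU, hbD⟩ := hbr L hL₁
  clear hA hW hbr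
  have hsecU := secant_rearrange_up hτ hβV hbU
  have hsecD := secant_rearrange_dn hτ hβV hbD
  clear hbU hbD
  -- the core estimate on the sector weights `W(N; μ)` and the partition function `Z(μ)` of this `L`
  have hcore := chernoffWalk_core
    (W := fun N μ => ∑ s ∈ (Finset.univ.filter fun s : Finset (Orb (FermionTorus 2 L)) => s.card = N),
      (Matrix.gibbsWeight β (hubbardTorusWith 2 L 1 U μ - ((g / (L : ℝ) ^ 2 : ℝ) : ℂ) •
        ((pairField dWaveFormFactor L)ᴴ * pairField dWaveFormFactor L)) s s).re)
    (Z := fun μ => (Matrix.partitionFn β (hubbardTorusWith 2 L 1 U μ - ((g / (L : ℝ) ^ 2 : ℝ) : ℂ) •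
      ((pairField dWaveFormFactor L)ᴴ * pairField dWaveFormFactor L))).re)
    L hL20 hβ hC hτ hη hη' hδ hZsum htilt hpos
    (fun n hnlo hn1 hnM => walk_ratio_down hβ0.le hC htilt (hpos μ₀ (n - 1) (by omega)) ((hWL n).1 hn1 hnM)
      hn1 hnlo)
    (fun n hnhi hnM => walk_ratio_up hβ0.le hC htilt (hpos μ₀ (n + 1) hnM) ((hWL n).2 hnM) hnhi (by nlinarith))
    hsecU hsecD hLτη
  clear hZsum htilt hpos hWL hsecU hsecD
  -- the normal form at N_L
  have hn : ⌊(1 - δ) * (L : ℝ) ^ 2 / 2⌋₊ ≤ L ^ 2 := by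
    have hδ0 : 0 ≤ 1 - δ := by linarith [hδ.2]
    have h0 : (1 - δ) * (L : ℝ) ^ 2 ≤ 1 * (L : ℝ) ^ 2 :=
      mul_le_mul_of_nonneg_right (by linarith [hδ.1]) hVpos.le
    have h1 : (1 - δ) * (L : ℝ) ^ 2 / 2 ≤ ((L ^ 2 : ℕ) : ℝ) := by
      push_cast
      have : 0 ≤ (1 - δ) * (L : ℝ) ^ 2 := mul_nonneg hδ0 hVpos.le
      linarith
    exact (Nat.floor_le_floor h1).trans_eq (Nat.floor_natCast _)
  have hnf' := hnf μ₀ _ hn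
  clear hnf
  rw [Nat.cast_mul, Nat.cast_ofNat] at hnf'
  exact closer_divide hβ0 hVpos (hnf'.trans (add_le_add le_rfl hcore)) hRHS

end

end Summit.HubbardSuperconductivity.HubbardSuperconductivity.Theorems.TwSeededEnsembleEquivalence.ThermalDuality
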